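import Literature.Computability.Complexity.Williams2014ConvCode
import HarnessLib

/-!
# The `ACC → SYM⁺` conversion on codes with a budget

R. Williams, *Nonuniform ACC circuit lower bounds*, J. ACM 61 (2014), Lemma 4.1 and Appendix A:
the conversion is an algorithm of running time `s^{O(log^{f(d)} s)}`; in the tree it becomes a
polynomial-time function on codes padded by a quasi-polynomial unary budget `B`
(`Williams2014_lemma_4_1_of_FP`, `Williams2014Lemma41Reduction.lean`; Arora–Barak 2009, §2.6.2).
A function of the typed calculus `CodeFP` must be total and polynomially bounded on EVERY string,
while the conversion `convCode` (`Williams2014ConvCode.lean`) produces quasi-polynomially long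
intermediate data. This file defines the budgeted variant **`convCodeB d m B`** — the same pipeline
with every loop that is not bounded by the input guarded by the budget: ranges
`List.range (min · B)`, unary exponents `min B ·`, binary logarithms by at most `B` halvings, and the
two growing folds (modulus amplification on tokens, the stack expansion) reset to the empty default
as soon as the accumulator's code would exceed `B` bits (`capTo`) — and proves the **budget lemma**
`convCodeB_eq_convCode`: if the genuine run fits the budget (`CapFits`), then
`convCodeB d m B = convCode d m` on the code of the circuit. The inequalities of `CapFits` are
discharged from one quasi-polynomial bound in `Williams2014ConvBounds.lean`; the `CodeFP` derivation
of `convCodeB` is in `Williams2014ConvFP*.lean`.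

Also here: the string codes of tokens, keyed polynomials and stacks (`tokE`, `kpolyE`, `stackE`) in
the `CodeFP` encoders, since the caps are stated on code lengths.

No new named fact; everything is proved.

## References

* R. Williams, *Nonuniform ACC circuit lower bounds*, J. ACM 61 (2014), Lemma 4.1, Appendix A
  [Williams2014].
* S. Arora, B. Barak, *Computational Complexity: A Modern Approach*, CUP 2009, §2.6.2 (padding)
  [AroraBarak2009].
-/

namespace Literature.Computability.Complexity

open Finset SatCode GateList CodeFP

namespace BT

variable {n : ℕ}

/-! ### Codes -/

/-- A token as a tuple `(tag, c, j, q, z)`. [folklore] -/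
def tokTuple : Tok → ℕ × ℕ × ℕ × ℕ × ℤ
  | Tok.inp i => (0, i, 0, 0, 0)
  | Tok.gv c j q => (1, c, j, q, 0)
  | Tok.cst z => (2, 0, 0, 0, z)
  | Tok.add => (3, 0, 0, 0, 0)
  | Tok.mul => (4, 0, 0, 0, 0)

/-- `tokTuple` is injective. [folklore] -/
theorem tokTuple_injective : Function.Injective tokTuple := by
  intro t₁ t₂ h
  cases t₁ <;> cases t₂ <;> simp_all [tokTuple]

/-- The code of a token tuple. [folklore] -/
abbrev tupE : ℕ × ℕ × ℕ × ℕ × ℤ → List Bool := pairE natE (pairE natE (pairE natE (pairE natE intE)))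

/-- The code of a token. [folklore] -/
def tokE : Tok → List Bool := fun t => tupE (tokTuple t)

/-- The code of a token list. [folklore] -/
abbrev toksE : List Tok → List Bool := rawE tokE

/-- The code of a keyed monomial. [folklore] -/
abbrev kmonoE : ℤ × List ℕ → List Bool := pairE intE (rawE natE)

/-- The code of a keyed polynomial. [folklore] -/
abbrev kpolyE : KPoly → List Bool := rawE kmonoE

/-- The code of a stack of keyed polynomials. [folklore] -/
abbrev stackE : List KPoly → List Bool := rawE kpolyE

/-- The code of the source-literal table. [folklore] -/
abbrev srcE : List (Bool × WireC) → List Bool := rawE (pairE bitE wireE)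

/-! ### The cap -/

/-- **Capping by the budget**: keep `x` if its code has at most `B` bits, else the default.
[cite: AroraBarak2009, §2.6.2] -/
def capTo {β : Type} (e : β → List Bool) (B : ℕ) (dflt x : β) : β := if (e x).length ≤ B then x else dflt

/-- An inactive cap. [folklore] -/
theorem capTo_of_le {β : Type} {e : β → List Bool} {B : ℕ} (dflt : β) {x : β} (h : (e x).length ≤ B) :
    capTo e B dflt x = x := if_pos h

/-- **A capped fold whose genuine run fits the budget is the genuine fold.** [folklore] -/
theorem foldl_capTo_eq {α β : Type} (e : β → List Bool) (B : ℕ) (dflt : β) (f : β → α → β) :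
    ∀ (l : List α) (b : β), (∀ l₁, l₁ <+: l → l₁ ≠ [] → (e (l₁.foldl f b)).length ≤ B) →
      l.foldl (fun acc a => capTo e B dflt (f acc a)) b = l.foldl f b
  | [], b, _ => rfl
  | a :: l, b, h => by
    have h1 : (e (f b a)).length ≤ B := by simpa using h [a] ⟨l, rfl⟩ (List.cons_ne_nil a [])
    rw [List.foldl_cons, List.foldl_cons, capTo_of_le dflt h1]
    exact foldl_capTo_eq e B dflt f l (f b a) fun l₁ hl₁ _ => by
      obtain ⟨l₂, hl₂⟩ := hl₁
      simpa using h (a :: l₁) ⟨l₂, by rw [← hl₂]; rfl⟩ (List.cons_ne_nil a l₁)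

/-- An iteration with an inactive cap. [folklore] -/
theorem foldl_replicate_capTo_eq {β : Type} (e : β → List Bool) (B : ℕ) (dflt : β) (f : β → β) (κ : ℕ) (b : β)
    (h : ∀ i, i ≤ κ → (e (f^[i] b)).length ≤ B) :
    (List.replicate κ ()).foldl (fun acc _ => capTo e B dflt (f acc)) b = f^[κ] b := by
  have key : ∀ (i : ℕ) (b : β), (List.replicate i ()).foldl (fun acc (_ : Unit) => f acc) b = f^[i] b := by
    intro i; induction i with
    | zero => intro b; rfl
    | succ i ih => intro b; rw [List.replicate_succ, List.foldl_cons, ih, ← Function.iterate_succ_apply]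
  rw [← key κ b]
  refine foldl_capTo_eq e B dflt (fun acc (_ : Unit) => f acc) _ b fun l₁ hl₁ _ => ?_
  have hlen : l₁.length ≤ κ := by simpa using hl₁.length_le
  have hl₁eq : l₁ = List.replicate l₁.length () := List.eq_replicate_iff.2 ⟨rfl, fun u _ => by cases u; rfl⟩
  rw [hl₁eq, key]
  exact h _ hlen

/-! ### Budgeted primitives -/

/-- A binary digit with a budgeted shift. [folklore] -/
def bitNB (B c i : ℕ) : ℕ := c / 2 ^ min i B % 2

/-- Row sums of the Valiant–Vazirani hash with budgeted loops (`μ = vvMu s` passed as data). [folklore] -/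
def vvRowSumB (B mu c r ρ a : ℕ) : ℕ :=
  (((List.range (min mu B)).map fun i => bitNB B c ((r * (mu + 2) + ρ) * (mu + 1) + i) * bitNB B a i).sum) +
    bitNB B c ((r * (mu + 2) + ρ) * (mu + 1) + mu)

/-- The seed test with budgeted loops. [folklore] -/
def vvSeedB (B mu c t a : ℕ) : Bool :=
  (List.range (min (t % (mu + 3)) B)).all fun ρ => decide (vvRowSumB B mu c (t / (mu + 3)) ρ a % 2 = 0)

/-- AND tokens with budgeted loops. [folklore] -/
def andToksB (B mu T₀ : ℕ) (src : List (Bool × WireC)) (c : ℕ) (ws : List WireC) : List Tok :=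
  prodLToks ((List.range (min T₀ B)).map fun t =>
    oneSubToks (sumLToks (((List.range ws.length).filter fun a => vvSeedB B mu c t a).map fun a =>
      oneSubToks (litToksC src c (ws.getD a (0, 0))))))

/-- OR tokens with budgeted loops. [folklore] -/
def orToksB (B mu T₀ : ℕ) (src : List (Bool × WireC)) (c : ℕ) (ws : List WireC) : List Tok :=
  oneSubToks (prodLToks ((List.range (min T₀ B)).map fun t =>
    oneSubToks (sumLToks (((List.range ws.length).filter fun a => vvSeedB B mu c t a).map fun a =>
      litToksC src c (ws.getD a (0, 0))))))

/-- Tokens of the defining polynomials with budgeted loops. [folklore] -/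
def ffToksB (B m mu T₀ : ℕ) (gs : List GateC) (src : List (Bool × WireC)) (c j q : ℕ) : List Tok :=
  if j < gs.length then
    if q = 0 then
      if (gs.getD j (0, [])).1 = 1 then andToksB B mu T₀ src c (gs.getD j (0, [])).2
      else if (gs.getD j (0, [])).1 = 2 then orToksB B mu T₀ src c (gs.getD j (0, [])).2
      else modToksC m c j
    else auxToksC m src c (gs.getD j (0, [])).2 q
  else [Tok.cst 0]

/-- The budgeted amplification depth: at most `B` halvings in the logarithm. [folklore] -/
def kapB (B lam a e₀ k : ℕ) : ℕ := min B (Nat.log 2 (lam ^ Setup.Eexp a e₀ k + 2)) + 1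

/-- The capped modulus amplification on tokens. [folklore] -/
def todaIterB (B κ : ℕ) (g : List Tok) : List Tok :=
  (List.replicate κ ()).foldl (fun acc _ => capTo toksE B [] (todaToks acc)) g

/-- The stage substitution on tokens with a budget. [folklore] -/
def substTokB (B m mu T₀ lam a e₀ Lmax k : ℕ) (gs : List GateC) (ds : List ℕ) (src : List (Bool × WireC)) :
    Tok → List Tok
  | Tok.gv c j q =>
    if admC m gs j q = true ∧ levC m ds j q = Lmax - k then
      todaIterB B (kapB B lam a e₀ k)
        (powToks (max 2 (stagePrimeC m (Lmax - k)) - 1) (ffToksB B m mu T₀ gs src c j q))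
    else [Tok.gv c j q]
  | t => [t]

/-- The tokens of the top formula with a budgeted number of copies. [folklore] -/
def topToksB (B T : ℕ) (src : List (Bool × WireC)) (out : WireC) : List Tok :=
  sumLToks ((List.range (min T B)).map fun c => litToksC src c out)

/-- The tokens after `k` stages, budgeted. [folklore] -/
def toksB (B m mu T₀ T lam a e₀ Lmax : ℕ) (gs : List GateC) (ds : List ℕ) (src : List (Bool × WireC))
    (out : WireC) : ℕ → List Tok
  | 0 => topToksB B T src out
  | k + 1 => (toksB B m mu T₀ T lam a e₀ Lmax gs ds src out k).flatMap (substTokB B m mu T₀ lam a e₀ Lmax k gs ds src)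

/-- The capped stack expansion. [folklore] -/
def expandB (B : ℕ) (toks : List Tok) : KPoly :=
  (toks.foldl (fun st t => capTo stackE B [] (stackStep st t)) []).headD []

/-- The flattened code of the AND-terms with budgeted multiplicities. [folklore] -/
def termsCodeB (B : ℕ) (P : KPoly) (M : ℕ) : List ℕ :=
  P.flatMap fun q => (List.replicate (min ((q.1 % (M : ℤ)).toNat) B) (q.2.length :: q.2.map (· / 2))).flatten

/-- The budgeted weight bound `2^{min B λ^E}`. [folklore] -/
def WbB (B lam a e₀ k : ℕ) : ℕ := 2 ^ min (lam ^ Setup.Eexp a e₀ k) B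

/-- The budgeted final modulus. [folklore] -/
def KfB (B lam a e₀ L : ℕ) : ℕ := 2 * WbB B lam a e₀ L + 1

/-- The budgeted stage modulus. [folklore] -/
def MkB (B m lam a e₀ Lmax k : ℕ) : ℕ :=
  (max 2 (stagePrimeC m (Lmax - k))) ^ min (2 ^ min (kapB B lam a e₀ k) B) B

/-- The budgeted decoder chain. [folklore] -/
def chainB (B m lam a e₀ Lmax : ℕ) : ℕ → ℤ → ℤ
  | 0 => id
  | k + 1 => chainB B m lam a e₀ Lmax k ∘ fun z =>
      (z + WbB B lam a e₀ k) % (MkB B m lam a e₀ Lmax k : ℤ) - WbB B lam a e₀ k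

/-- The budgeted symmetric gate. [folklore] -/
def symOfB (B m T lam a e₀ Lmax N : ℕ) : Bool :=
  decide ((T : ℤ) < 2 * chainB B m lam a e₀ Lmax Lmax
    ((((N : ℕ) : ℤ) + WbB B lam a e₀ Lmax) % (KfB B lam a e₀ Lmax : ℤ) - WbB B lam a e₀ Lmax))

/-- **The budgeted conversion on codes.** [cite: Williams2014, Lemma 4.1 and Appendix A] -/
def convCodeB (d m B : ℕ) (inp : ℕ × WireC × List GateC) : List ℕ :=
  let gs := inp.2.2
  let s := szC gs
  let lam := Nat.log 2 s + 2
  let Lmax := (m + 1) * d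
  let T := 2 ^ min (vvBits s) B
  let P := expandB B (toksB B m (vvMu s) (vvT₀ s) T lam (4 * m + 10) 7 Lmax gs (depthsC gs) (srcTableC gs) inp.2.1 Lmax)
  let M := KfB B lam (4 * m + 10) 7 Lmax
  inp.1 :: sizeCode P M :: termsCodeB B P M ++
    (List.range (min (sizeCode P M + 1) B)).map fun N => if symOfB B m T lam (4 * m + 10) 7 Lmax N then 1 else 0

/-! ### The budget lemma -/

section budget

variable (d m B : ℕ) (C : Circuit (Fin n))

/-- The data of the genuine run that must fit the budget `B`: the number of copies and of tests,
the seed length, the exponents / logarithms / amplification depths of the stages, the token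
strings of the modulus amplifications actually performed, the stacks of the expansion, the final
modulus and the number of AND-terms. [cite: AroraBarak2009, §2.6.2] -/
structure CapFits : Prop where
  bits_le : vvBits (sC C) ≤ B
  T_le : vvT (sC C) ≤ B
  T₀_le : vvT₀ (sC C) ≤ B
  pow_le : ∀ k, k ≤ (m + 1) * d → lamC C ^ Setup.Eexp (4 * m + 10) 7 k ≤ B
  log_le : ∀ k, k ≤ (m + 1) * d → Nat.log 2 (lamC C ^ Setup.Eexp (4 * m + 10) 7 k + 2) ≤ B
  kap_le : ∀ k, k < (m + 1) * d → 2 ^ Setup.kap (lamC C) (4 * m + 10) 7 k ≤ B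
  toda_le : ∀ k, k < (m + 1) * d → ∀ c j q : ℕ,
    Tok.gv c j q ∈ toksC m (sC C) (vvT₀ (sC C)) (vvT (sC C)) (lamC C) (4 * m + 10) 7 ((m + 1) * d)
      (gcodes m C) (depthsC (gcodes m C)) (srcTableC (gcodes m C)) (wireC C.output) k →
    (admC m (gcodes m C) j q = true ∧ levC m (depthsC (gcodes m C)) j q = (m + 1) * d - k) →
    ∀ i, i ≤ Setup.kap (lamC C) (4 * m + 10) 7 k →
      (toksE (todaToks^[i] (powToks (max 2 (stagePrimeC m ((m + 1) * d - k)) - 1)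
        (ffToksC m (sC C) (vvT₀ (sC C)) (gcodes m C) (srcTableC (gcodes m C)) c j q)))).length ≤ B
  stack_le : ∀ tp : List Tok,
    tp <+: toksC m (sC C) (vvT₀ (sC C)) (vvT (sC C)) (lamC C) (4 * m + 10) 7 ((m + 1) * d)
      (gcodes m C) (depthsC (gcodes m C)) (srcTableC (gcodes m C)) (wireC C.output) ((m + 1) * d) →
    (stackE (tp.foldl stackStep [])).length ≤ B
  Kf_le : Setup.Kf (lamC C) (4 * m + 10) 7 ((m + 1) * d) ≤ B
  size_le : sizeCode (expandToks (toksC m (sC C) (vvT₀ (sC C)) (vvT (sC C)) (lamC C) (4 * m + 10) 7 ((m + 1) * d)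
      (gcodes m C) (depthsC (gcodes m C)) (srcTableC (gcodes m C)) (wireC C.output) ((m + 1) * d)))
      (Setup.Kf (lamC C) (4 * m + 10) 7 ((m + 1) * d)) + 1 ≤ B

variable {d m B C}

/-- `μ + 2 ≤ vvBits`. [folklore] -/
theorem vvMu_add_two_le_vvBits (s : ℕ) : vvMu s + 2 ≤ vvBits s := by
  unfold vvBits vvR vvK
  calc vvMu s + 2 ≤ (vvMu s + 2) * (vvMu s + 1) := Nat.le_mul_of_pos_right _ (Nat.succ_pos _)
    _ ≤ 6 * (Nat.log 2 s + 2) * ((vvMu s + 2) * (vvMu s + 1)) := Nat.le_mul_of_pos_left _ (by positivity)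

/-- With enough budget the digits are exact. [folklore] -/
theorem bitNB_eq {B c i : ℕ} (h : i ≤ B) : bitNB B c i = bitN c i := by
  rw [bitNB, bitN, min_eq_left h]

/-- **With enough budget the seed test is exact** (for the tests `t < vvT₀ s`). [folklore] -/
theorem vvSeedB_eq {s B : ℕ} (hB : vvBits s ≤ B) (c j : ℕ) {t : ℕ} (ht : t < vvT₀ s) (a : ℕ) :
    vvSeedB B (vvMu s) c t a = vvSeed s c j t a := by
  have hK : vvMu s + 3 = vvK s + 1 := rfl
  have hmu : vvMu s + 2 ≤ B := (vvMu_add_two_le_vvBits s).trans hB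
  have hr : t / (vvK s + 1) < vvR s := by
    rw [Nat.div_lt_iff_lt_mul (Nat.succ_pos _)]; exact ht
  have hrow : ∀ ρ, ρ < t % (vvK s + 1) → vvRowSumB B (vvMu s) c (t / (vvK s + 1)) ρ a = vvRowSum s c (t / (vvK s + 1)) ρ a := by
    intro ρ hρ
    have hρK : ρ < vvK s := Nat.lt_of_lt_of_le hρ (Nat.le_of_lt_succ (Nat.mod_lt _ (Nat.succ_pos _)))
    have hidx : ∀ i, i ≤ vvMu s → vvIdx s (t / (vvK s + 1)) ρ i ≤ B := fun i hi =>
      (vvIdx_lt s ⟨_, hr⟩ ⟨ρ, hρK⟩ hi).le.trans hB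
    show (((List.range (min (vvMu s) B)).map fun i =>
        bitNB B c (vvIdx s (t / (vvK s + 1)) ρ i) * bitNB B a i).sum) + bitNB B c (vvIdx s (t / (vvK s + 1)) ρ (vvMu s)) =
      (((List.range (vvMu s)).map fun i => bitN c (vvIdx s (t / (vvK s + 1)) ρ i) * bitN a i).sum) +
        bitN c (vvIdx s (t / (vvK s + 1)) ρ (vvMu s))
    rw [min_eq_left (by omega : vvMu s ≤ B), bitNB_eq (hidx _ le_rfl)]
    congr 2
    refine List.map_congr_left fun i hi => ?_
    rw [List.mem_range] at hi
    rw [bitNB_eq (hidx i hi.le), bitNB_eq (by omega)]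
  have hmod : t % (vvK s + 1) ≤ B := (Nat.le_of_lt_succ (Nat.mod_lt _ (Nat.succ_pos _))).trans hmu
  rw [vvSeedB, vvSeed, hK, min_eq_left hmod]
  rw [Bool.eq_iff_iff, List.all_eq_true, decide_eq_true_iff]
  simp only [List.mem_range, decide_eq_true_iff]
  constructor
  · intro h ρ hρ; rw [← hrow ρ hρ]; exact h ρ hρ
  · intro h ρ hρ; rw [hrow ρ hρ]; exact h ρ hρ

/-- **With enough budget the tokens of the defining polynomials are exact.** [folklore] -/
theorem ffToksB_eq {s B : ℕ} (hB : vvBits s ≤ B) (hT₀ : vvT₀ s ≤ B) (m : ℕ) (gs : List GateC)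
    (src : List (Bool × WireC)) (c j q : ℕ) :
    ffToksB B m (vvMu s) (vvT₀ s) gs src c j q = ffToksC m s (vvT₀ s) gs src c j q := by
  have hsel : ∀ (t : ℕ), t < vvT₀ s → ∀ (ws : List WireC),
      (List.range ws.length).filter (fun a => vvSeedB B (vvMu s) c t a) =
        (List.range ws.length).filter fun a => vvSeed s c j t a := fun t ht ws =>
    List.filter_congr fun a _ => vvSeedB_eq hB c j ht a
  have hand : ∀ ws, andToksB B (vvMu s) (vvT₀ s) src c ws = andToksC s (vvT₀ s) src c j ws := fun ws => by
    unfold andToksB andToksC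
    rw [min_eq_left hT₀]
    congr 1
    refine List.map_congr_left fun t ht => ?_
    rw [List.mem_range] at ht
    rw [hsel t ht ws]
  have hor : ∀ ws, orToksB B (vvMu s) (vvT₀ s) src c ws = orToksC s (vvT₀ s) src c j ws := fun ws => by
    unfold orToksB orToksC
    rw [min_eq_left hT₀]
    congr 2
    refine List.map_congr_left fun t ht => ?_
    rw [List.mem_range] at ht
    rw [hsel t ht ws]
  unfold ffToksB ffToksC
  simp only [hand, hor]

/-- With enough budget the amplification depth is exact. [folklore] -/
theorem kapB_eq {B lam a e₀ k : ℕ} (h : Nat.log 2 (lam ^ Setup.Eexp a e₀ k + 2) ≤ B) :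
    kapB B lam a e₀ k = Setup.kap lam a e₀ k := by
  rw [kapB, Setup.kap, min_eq_right h]

/-- **With enough budget the tokens of all stages are exact.** [folklore] -/
theorem toksB_eq (h : CapFits d m B C) : ∀ k, k ≤ (m + 1) * d →
    toksB B m (vvMu (sC C)) (vvT₀ (sC C)) (2 ^ min (vvBits (sC C)) B) (lamC C) (4 * m + 10) 7 ((m + 1) * d)
      (gcodes m C) (depthsC (gcodes m C)) (srcTableC (gcodes m C)) (wireC C.output) k =
    toksC m (sC C) (vvT₀ (sC C)) (vvT (sC C)) (lamC C) (4 * m + 10) 7 ((m + 1) * d)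
      (gcodes m C) (depthsC (gcodes m C)) (srcTableC (gcodes m C)) (wireC C.output) k
  | 0, _ => by
    rw [toksB, toksC, topToksB, topToksC, min_eq_left h.bits_le, ← vvT, min_eq_left h.T_le]
  | k + 1, hk => by
    have hk' : k < (m + 1) * d := hk
    rw [toksB, toksC, toksB_eq h k (Nat.le_of_succ_le hk)]
    refine List.flatMap_congr fun t ht => ?_
    cases t with
    | gv c j q =>
      rw [substTokB, substTokC_gv]
      split_ifs with hb
      · rw [kapB_eq (h.log_le k (Nat.le_of_succ_le hk)), ffToksB_eq h.bits_le h.T₀_le, todaIterB]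
        exact foldl_replicate_capTo_eq toksE B [] todaToks _ _ (h.toda_le k hk' c j q ht hb)
      · rfl
    | inp i => rfl
    | cst z => rfl
    | add => rfl
    | mul => rfl

/-- **With enough budget the expansion is exact.** [folklore] -/
theorem expandB_eq {B : ℕ} {toks : List Tok} (h : ∀ tp : List Tok, tp <+: toks → (stackE (tp.foldl stackStep [])).length ≤ B) :
    expandB B toks = expandToks toks := by
  rw [expandB, expandToks, runToks, foldl_capTo_eq stackE B [] stackStep toks [] fun tp htp _ => h tp htp]

/-- With enough budget the multiplicities are exact. [folklore] -/
theorem termsCodeB_eq {B : ℕ} (P : KPoly) {M : ℕ} (hM0 : 0 < M) (hM : M ≤ B) : termsCodeB B P M = termsCode P M := by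
  unfold termsCodeB termsCode
  refine List.flatMap_congr fun q _ => ?_
  rw [min_eq_left]
  have h1 : q.1 % (M : ℤ) < M := Int.emod_lt_of_pos _ (by exact_mod_cast hM0)
  have h2 : (q.1 % (M : ℤ)).toNat < M := by
    rw [Int.toNat_lt (Int.emod_nonneg _ (by exact_mod_cast hM0.ne'))]; exact h1
  omega

/-- With enough budget the weight bounds are exact. [folklore] -/
theorem WbB_eq {B lam a e₀ k : ℕ} (h : lam ^ Setup.Eexp a e₀ k ≤ B) : WbB B lam a e₀ k = Setup.Wb lam a e₀ k := by
  rw [WbB, Setup.Wb, min_eq_left h]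

/-- With enough budget the decoder chain is exact. [folklore] -/
theorem chainB_eq (h : CapFits d m B C) : ∀ k, k ≤ (m + 1) * d →
    chainB B m (lamC C) (4 * m + 10) 7 ((m + 1) * d) k = chainC m (lamC C) (4 * m + 10) 7 ((m + 1) * d) k
  | 0, _ => rfl
  | k + 1, hk => by
    have hk' : k < (m + 1) * d := hk
    rw [chainB, chainC, chainB_eq h k (Nat.le_of_succ_le hk), WbB_eq (h.pow_le k (Nat.le_of_succ_le hk)), MkB,
      kapB_eq (h.log_le k (Nat.le_of_succ_le hk))]
    have h1 : Setup.kap (lamC C) (4 * m + 10) 7 k ≤ B :=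
      (Nat.lt_two_pow_self).le.trans (h.kap_le k hk')
    rw [min_eq_left h1, min_eq_left (h.kap_le k hk')]

/-- With enough budget the symmetric gate is exact. [folklore] -/
theorem symOfB_eq (h : CapFits d m B C) (N : ℕ) :
    symOfB B m (2 ^ min (vvBits (sC C)) B) (lamC C) (4 * m + 10) 7 ((m + 1) * d) N =
      symOfC m (vvT (sC C)) (lamC C) (4 * m + 10) 7 ((m + 1) * d) N := by
  rw [symOfB, symOfC, chainB_eq h _ le_rfl, KfB, WbB_eq (h.pow_le _ le_rfl), min_eq_left h.bits_le, Setup.Kf, vvT]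

/-- **The budget lemma**: if the genuine run fits the budget, the budgeted conversion is the
conversion. [cite: AroraBarak2009, §2.6.2] -/
theorem convCodeB_eq_convCode (h : CapFits d m B C) :
    convCodeB d m B (n, wireC C.output, gcodes m C) = convCode d m (n, wireC C.output, gcodes m C) := by
  have hlam : Nat.log 2 (szC (gcodes m C)) + 2 = lamC C := by rw [szC_eq]; rfl
  have hP : expandB B (toksB B m (vvMu (szC (gcodes m C))) (vvT₀ (szC (gcodes m C)))
      (2 ^ min (vvBits (szC (gcodes m C))) B) (Nat.log 2 (szC (gcodes m C)) + 2) (4 * m + 10) 7 ((m + 1) * d)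
      (gcodes m C) (depthsC (gcodes m C)) (srcTableC (gcodes m C)) (wireC C.output) ((m + 1) * d)) =
      expandToks (toksC m (szC (gcodes m C)) (vvT₀ (szC (gcodes m C))) (vvT (szC (gcodes m C)))
        (Nat.log 2 (szC (gcodes m C)) + 2) (4 * m + 10) 7 ((m + 1) * d)
        (gcodes m C) (depthsC (gcodes m C)) (srcTableC (gcodes m C)) (wireC C.output) ((m + 1) * d)) := by
    rw [hlam, szC_eq, toksB_eq h _ le_rfl]
    exact expandB_eq h.stack_le
  have hKf : KfB B (Nat.log 2 (szC (gcodes m C)) + 2) (4 * m + 10) 7 ((m + 1) * d) =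
      Setup.Kf (lamC C) (4 * m + 10) 7 ((m + 1) * d) := by
    rw [hlam, KfB, WbB_eq (h.pow_le _ le_rfl), Setup.Kf]
  have hsym : (fun N => if symOfB B m (2 ^ min (vvBits (szC (gcodes m C))) B) (Nat.log 2 (szC (gcodes m C)) + 2)
      (4 * m + 10) 7 ((m + 1) * d) N then 1 else 0) = (fun N => if symOfC m (vvT (szC (gcodes m C)))
      (Nat.log 2 (szC (gcodes m C)) + 2) (4 * m + 10) 7 ((m + 1) * d) N then 1 else 0) := by
    funext N; rw [hlam, szC_eq, symOfB_eq h]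
  simp only [convCodeB, convCode]
  rw [hP, hKf, hsym, termsCodeB_eq _ (by unfold Setup.Kf; omega) h.Kf_le, szC_eq, min_eq_left]
  · rfl
  · have := h.size_le; rw [szC_eq] at hP; simpa [lamC] using this

end budget

end BT

end Literature.Computability.Complexity
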